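import Summits.HubbardSuperconductivity.HubbardSuperconductivity.Theorems.AnisotropyChordTransferFibre3TwoMagnonQF
import Summits.HubbardSuperconductivity.HubbardSuperconductivity.Theorems.AnisotropyChordTransferFibre3ShellK
import Summits.HubbardSuperconductivity.HubbardSuperconductivity.Theorems.AnisotropyChordTransferFibre3IMS

/-!
# Route `AnisotropyChord` / H0 rotor rung: the Jastrow–Feynman product state of the GROUND two-magnon profile

Memo ROTOR-THEORY-21 §301 STEP 0/STEP 2 (theory seat `hubbard-h0-rotor-theory-1`): for the ground profile `f`
(`IsGroundTwoMagnon`, hence `f > 0` off the origin by `ground_pos`) the `K = 0` product state `Π⁰(a,b) = f(a)f(b)f(b−a)` is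
* nonnegative, positive off the hard core (`prodState_pos_offD`), **admissible** in the `K = 0` sector (`prodState_admissible`);
* the pole overlap of the `K₁` trial state is positive: `Re⟨v, vΠ⁰⟩ > 0`, `⟨v,vΠ⁰⟩ ≠ 0` (`ip_vfun_trialK1_ne_zero`);
* **`Tplus_pos`**: `T⁺ = RQ₀(Π⁰) > 0` for `Δ < 1` (shell bound at `K = 0`: `⟨Π,HΠ⟩ ≥ (1−Δ)Σ W|Π|² > 0`), `Tplus_nonneg` for `Δ ≤ 1`;
* **`denMinRest_holds`**: `DenMinRest L Δ ρ` for every `1 ≤ ρ ≤ 9/4` and `Δ ≤ 1` — free from the `5.5ε₁` cut of `IsLowShell`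
  (off the low set the free energy is `≥ 5.5ε₁`, so `den ≥ 4.5ε₁ − T⁺ ≥ ρ(2ε₁ − T⁺)`).
Prover seat `hubbard-h0-rotor-p1` g22; helper for stmt-HubbardSuperconductivity-19089 (`--supports`).
-/

set_option linter.dupNamespace false
set_option autoImplicit false

noncomputable section

open scoped BigOperators
open Complex

namespace Summit.HubbardSuperconductivity.HubbardSuperconductivity.Theorems.AnisotropyChord.Transfer.Fibre3

variable (L : ℕ) [NeZero L]

/-! ## Nonnegativity and positivity of `Π⁰` -/

/-- the ground profile is nonnegative everywhere. [folklore] -/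
theorem ground_nonneg (hL : 2 ≤ L) {Δ lam2 : ℝ} {f : Tor L → ℝ} (hf : IsGroundTwoMagnon L Δ lam2 f) (r : Tor L) :
    0 ≤ f r := by
  by_cases hr : r = 0
  · rw [hr, hf.1.1]
  · exact (ground_pos L hL hf r hr).le

omit [NeZero L] in
/-- the product state is real: `Π⁰ c = (f a f b f(b−a) : ℝ)`. [folklore] -/
theorem prodState_apply (f : Tor L → ℝ) (c : Cfg L) :
    prodState L f c = ((f c.1 * f c.2 * f (c.2 - c.1) : ℝ) : ℂ) := rfl

/-- `Π⁰ ≥ 0` (as a real number). [folklore] -/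
theorem prodState_re_nonneg (hL : 2 ≤ L) {Δ lam2 : ℝ} {f : Tor L → ℝ} (hf : IsGroundTwoMagnon L Δ lam2 f) (c : Cfg L) :
    0 ≤ f c.1 * f c.2 * f (c.2 - c.1) := by
  have h1 := ground_nonneg L hL hf c.1
  have h2 := ground_nonneg L hL hf c.2
  have h3 := ground_nonneg L hL hf (c.2 - c.1)
  positivity

omit [NeZero L] in
/-- `e_y − eₓ ≠ 0`, `eₓ ≠ 0`, `e_y ≠ 0` (`L ≥ 2`). [folklore] -/
theorem exy_ne (hL : 2 ≤ L) : ex L ≠ 0 ∧ ey L ≠ 0 ∧ ey L - ex L ≠ 0 := by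
  have h1 : (1 : ZMod L) ≠ 0 := by
    haveI : Fact (1 < L) := ⟨by omega⟩
    exact one_ne_zero
  refine ⟨fun h => h1 ?_, fun h => h1 ?_, fun h => h1 ?_⟩
  · have := congrArg Prod.fst h; simpa [ex] using this
  · have := congrArg Prod.snd h; simpa [ey] using this
  · have := congrArg Prod.fst h; simpa [ex, ey] using this

/-- `Π⁰(eₓ, e_y) > 0`. [folklore] -/
theorem prodState_exey_pos (hL : 2 ≤ L) {Δ lam2 : ℝ} {f : Tor L → ℝ} (hf : IsGroundTwoMagnon L Δ lam2 f) :
    0 < f (ex L) * f (ey L) * f (ey L - ex L) := by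
  obtain ⟨hx, hy, hxy⟩ := exy_ne L hL
  have h1 := ground_pos L hL hf _ hx
  have h2 := ground_pos L hL hf _ hy
  have h3 := ground_pos L hL hf _ hxy
  positivity

omit [NeZero L] in
/-- `(eₓ, e_y)` is off the hard core and on the shell side: `W(eₓ,e_y) ≥ 1`. [folklore] -/
theorem Wcount_exey_pos : 1 ≤ Wcount L (ex L, ey L) := by
  unfold Wcount
  have h1 := isNN_ex L
  have h2 := isNN_ey L
  simp only [h1, h2, if_true]
  split_ifs <;> omega

/-! ## Admissibility of `Π⁰` in the `K = 0` sector -/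

/-- `Π⁰` vanishes on the hard core. [folklore] -/
theorem prodState_D {Δ lam2 : ℝ} {f : Tor L → ℝ} (hf : IsGroundTwoMagnon L Δ lam2 f) (c : Cfg L) (hc : InD L c = true) :
    prodState L f c = 0 := by
  have h0 : f 0 = 0 := hf.1.1
  rw [prodState_apply]
  unfold InD at hc
  simp only [Bool.or_eq_true, decide_eq_true_eq] at hc
  rcases hc with (h | h) | h
  · rw [h, h0]; simp
  · rw [h, h0]; simp
  · rw [h, sub_self, h0]; simp

/-- **`Π⁰` is admissible in the `K = 0` sector** (symmetric under the two transpositions by evenness of `f`, vanishing on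
`D`, nonzero at `(eₓ,e_y)`). [folklore] -/
theorem prodState_admissible (hL : 2 ≤ L) {Δ lam2 : ℝ} {f : Tor L → ℝ} (hf : IsGroundTwoMagnon L Δ lam2 f) :
    Admissible L 0 (prodState L f) := by
  have heven : ∀ r, f (-r) = f r := hf.2.1
  refine ⟨⟨fun c => ?_, fun c => ?_⟩, prodState_D L hf, ?_⟩
  · rw [prodState_apply, prodState_apply]
    have : f (c.1 - c.2) = f (c.2 - c.1) := by rw [← heven (c.2 - c.1), neg_sub]
    simp only
    rw [this]; push_cast; ring
  · rw [phase_zero_left, one_mul, prodState_apply, prodState_apply]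
    simp only
    rw [heven c.1, show c.2 - c.1 - -c.1 = c.2 by abel]
    push_cast; ring
  · intro h
    have := congrFun h (ex L, ey L)
    rw [prodState_apply, Pi.zero_apply] at this
    have hpos := prodState_exey_pos L hL hf
    have : (f (ex L) * f (ey L) * f (ey L - ex L) : ℝ) = 0 := by exact_mod_cast this
    linarith

/-! ## The pole overlap of the trial state -/

/-- `⟨v, vΠ⁰⟩ = Σ_c |v(c)|² Π⁰(c)`, and its real part. [folklore] -/
theorem ip_vfun_trialK1_re (f : Tor L → ℝ) :
    (ip L (vfun L) (trialK1 L f)).re = ∑ c : Cfg L, Complex.normSq (vfun L c) * (f c.1 * f c.2 * f (c.2 - c.1)) := by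
  unfold ip trialK1
  rw [Complex.re_sum]
  refine Finset.sum_congr rfl fun c _ => ?_
  rw [prodState_apply, ← mul_assoc, ← Complex.normSq_eq_conj_mul_self, ← Complex.ofReal_mul, Complex.ofReal_re]

/-- `v(eₓ, e_y) ≠ 0` (`= 2 + e^{iθ}`). [folklore] -/
theorem vfun_exey_ne_zero : vfun L (ex L, ey L) ≠ 0 := by
  unfold vfun
  simp only
  rw [(phase_K1_ey L).1]
  intro h
  have hu : ‖phase L (K1 L) (ex L)‖ = 1 := norm_phase L (K1 L) (ex L)
  have : phase L (K1 L) (ex L) = -2 := by linear_combination h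
  rw [this] at hu
  norm_num at hu

/-- **the pole overlap is positive:** `Re⟨v, vΠ⁰⟩ > 0` for the ground profile (`L ≥ 2`). [folklore] -/
theorem ip_vfun_trialK1_re_pos (hL : 2 ≤ L) {Δ lam2 : ℝ} {f : Tor L → ℝ} (hf : IsGroundTwoMagnon L Δ lam2 f) :
    0 < (ip L (vfun L) (trialK1 L f)).re := by
  rw [ip_vfun_trialK1_re]
  have hterm : 0 < Complex.normSq (vfun L (ex L, ey L)) * (f (ex L) * f (ey L) * f (ey L - ex L)) :=
    mul_pos (Complex.normSq_pos.mpr (vfun_exey_ne_zero L)) (prodState_exey_pos L hL hf)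
  refine lt_of_lt_of_le hterm ?_
  refine Finset.single_le_sum (f := fun c : Cfg L => Complex.normSq (vfun L c) * (f c.1 * f c.2 * f (c.2 - c.1)))
    (fun c _ => mul_nonneg (Complex.normSq_nonneg _) (prodState_re_nonneg L hL hf c)) (Finset.mem_univ (ex L, ey L))

/-- `⟨v, vΠ⁰⟩ ≠ 0`. [folklore] -/
theorem ip_vfun_trialK1_ne_zero (hL : 2 ≤ L) {Δ lam2 : ℝ} {f : Tor L → ℝ} (hf : IsGroundTwoMagnon L Δ lam2 f) :
    ip L (vfun L) (trialK1 L f) ≠ 0 := by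
  intro h
  have := ip_vfun_trialK1_re_pos L hL hf
  rw [h, Complex.zero_re] at this
  exact lt_irrefl _ this

/-! ## `T⁺ > 0` -/

/-- `Re⟨F, H_Δ F⟩ = Re⟨F, H₀F⟩ − Δ Σ W|F|²`. [folklore] -/
theorem re_ip_Happly (K : Tor L) (Δ : ℝ) (F : Cfg L → ℂ) :
    (ip L F (Happly L K Δ F)).re = (ip L F (H0apply L K F)).re - Δ * ∑ c : Cfg L, (Wcount L c : ℝ) * ‖F c‖ ^ 2 := by
  unfold ip Happly
  rw [Complex.re_sum, Complex.re_sum, Finset.mul_sum, ← Finset.sum_sub_distrib]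
  refine Finset.sum_congr rfl fun c _ => ?_
  rw [mul_sub, Complex.sub_re]
  congr 1
  rw [show (starRingEnd ℂ) (F c) * ((Δ : ℂ) * (Wcount L c : ℂ) * F c) = ((Δ * (Wcount L c : ℝ) : ℝ) : ℂ) * ((starRingEnd ℂ) (F c) * F c) by
    push_cast; ring, Complex.re_ofReal_mul, Complex.conj_mul', show ((‖F c‖ : ℂ) ^ 2) = (((‖F c‖ ^ 2 : ℝ)) : ℂ) by
    push_cast; ring, Complex.ofReal_re]
  ring

/-- `‖Π⁰‖² > 0`. [folklore] -/
theorem ip_prodState_self_pos (hL : 2 ≤ L) {Δ lam2 : ℝ} {f : Tor L → ℝ} (hf : IsGroundTwoMagnon L Δ lam2 f) :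
    0 < (ip L (prodState L f) (prodState L f)).re := by
  rw [ip_self_re]
  have hterm : 0 < ‖prodState L f (ex L, ey L)‖ ^ 2 := by
    rw [prodState_apply, Complex.norm_real, Real.norm_of_nonneg (prodState_exey_pos L hL hf).le]
    exact pow_pos (prodState_exey_pos L hL hf) 2
  exact lt_of_lt_of_le hterm (Finset.single_le_sum (f := fun c : Cfg L => ‖prodState L f c‖ ^ 2)
    (fun c _ => sq_nonneg _) (Finset.mem_univ (ex L, ey L)))

/-- `Σ W|Π⁰|² > 0`. [folklore] -/
theorem shell_mass_prodState_pos (hL : 2 ≤ L) {Δ lam2 : ℝ} {f : Tor L → ℝ} (hf : IsGroundTwoMagnon L Δ lam2 f) :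
    0 < ∑ c : Cfg L, (Wcount L c : ℝ) * ‖prodState L f c‖ ^ 2 := by
  have hterm : 0 < (Wcount L (ex L, ey L) : ℝ) * ‖prodState L f (ex L, ey L)‖ ^ 2 := by
    have hW : (1 : ℝ) ≤ Wcount L (ex L, ey L) := by exact_mod_cast Wcount_exey_pos L
    have hn : 0 < ‖prodState L f (ex L, ey L)‖ ^ 2 := by
      rw [prodState_apply, Complex.norm_real, Real.norm_of_nonneg (prodState_exey_pos L hL hf).le]
      exact pow_pos (prodState_exey_pos L hL hf) 2
    nlinarith
  exact lt_of_lt_of_le hterm (Finset.single_le_sum (f := fun c : Cfg L => (Wcount L c : ℝ) * ‖prodState L f c‖ ^ 2)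
    (fun c _ => by positivity) (Finset.mem_univ (ex L, ey L)))

/-- the `K = 0` energy of `Π⁰`: `Re⟨Π, H_ΔΠ⟩ ≥ (1 − Δ) Σ W|Π|²`. [folklore] -/
theorem re_ip_Happly_prodState_ge {Δ lam2 : ℝ} {f : Tor L → ℝ} (hf : IsGroundTwoMagnon L Δ lam2 f) :
    (1 - Δ) * ∑ c : Cfg L, (Wcount L c : ℝ) * ‖prodState L f c‖ ^ 2
      ≤ (ip L (prodState L f) (Happly L 0 Δ (prodState L f))).re := by
  rw [re_ip_Happly]
  have := shell_le_dirichlet_K L 0 (prodState L f) (prodState_D L hf)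
  linarith

/-- **`T⁺ > 0`** for the ground profile and `Δ < 1` (`L ≥ 2`). [folklore] -/
theorem Tplus_pos (hL : 2 ≤ L) {Δ lam2 : ℝ} (hΔ : Δ < 1) {f : Tor L → ℝ} (hf : IsGroundTwoMagnon L Δ lam2 f) :
    0 < Tplus L Δ f := by
  unfold Tplus RQ
  apply div_pos _ (ip_prodState_self_pos L hL hf)
  have h1 := re_ip_Happly_prodState_ge L hf
  have h2 := shell_mass_prodState_pos L hL hf
  have : 0 < (1 - Δ) * ∑ c : Cfg L, (Wcount L c : ℝ) * ‖prodState L f c‖ ^ 2 := mul_pos (by linarith) h2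
  linarith

/-- `T⁺ ≥ 0` for `Δ ≤ 1`. [folklore] -/
theorem Tplus_nonneg (hL : 2 ≤ L) {Δ lam2 : ℝ} (hΔ : Δ ≤ 1) {f : Tor L → ℝ} (hf : IsGroundTwoMagnon L Δ lam2 f) :
    0 ≤ Tplus L Δ f := by
  unfold Tplus RQ
  apply div_nonneg _ (ip_prodState_self_pos L hL hf).le
  have h1 := re_ip_Happly_prodState_ge L hf
  have h2 := shell_mass_prodState_pos L hL hf
  have : 0 ≤ (1 - Δ) * ∑ c : Cfg L, (Wcount L c : ℝ) * ‖prodState L f c‖ ^ 2 := mul_nonneg (by linarith) h2.le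
  linarith

/-! ## `DenMinRest` from the `5.5ε₁` cut -/

/-- **`DenMinRest L Δ ρ` for `1 ≤ ρ ≤ 9/4`, `Δ ≤ 1`, `L ≥ 2`:** off the poles and the low set the free energy is `≥ 5.5ε₁`
(definition of `IsLowShell`), so `den(T⁺) ≥ 4.5ε₁ − T⁺ ≥ ρ(2ε₁ − T⁺)` as `T⁺ ≥ 0`. [folklore] -/
theorem denMinRest_holds (hL : 2 ≤ L) {Δ : ℝ} (hΔ : Δ ≤ 1) {ρ : ℝ} (h1 : 1 ≤ ρ) (h2 : ρ ≤ 9 / 4) :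
    DenMinRest L Δ ρ := by
  intro lam2 f hf k₂ k₃ hpole hlow
  have hT := Tplus_nonneg L hL hΔ hf
  have hfree : 5.5 * eps1 L ≤ epsT L (K1 L - k₂ - k₃) + epsT L k₂ + epsT L k₃ := by
    by_contra h
    exact hlow ⟨hpole, lt_of_not_ge h⟩
  have he : 0 ≤ eps1 L := by
    unfold eps1; linarith [Real.cos_le_one (2 * Real.pi / L)]
  unfold den
  nlinarith

end Summit.HubbardSuperconductivity.HubbardSuperconductivity.Theorems.AnisotropyChord.Transfer.Fibre3

end
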